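import Summits.CriticalPhenomena.CardyFormulaZ2.Theorems.CardyComplexConeParafermionToSLESixFamiliesDiamondDefs
import Literature.Probability.RandomPlanarGeometry.ConformalRectangleProofs
import HarnessLib

/-!
# Line `potential-darboux-picard-diamond`, stub S4 (`stub_identifyPotential`): dilation invariance of `ψ′/ψ`

Helper file of the stub `stub_identifyPotential` of crux `ParafermionToSLESixFamilies` (stmt-CriticalPhenomena-11389):
the conclusion `PotentialConformalLimit` of `…DiamondDefs` asks for the identity `(G′)³ = c · ψ′/ψ` for EVERY chordal
uniformizer `φ : ℍ → D` (`ψ = φ⁻¹`, boundary values `0 ↦ a`, `∞ ↦ b`) with ONE constant `c`. This file reduces "every" to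
"one": two chordal uniformizers differ by a dilation of `ℍ` (`IsChordalUniformizing.exists_eq_trans_smul_holds`, Lawler
(2005) §6.1, PROVED in the tree from Carathéodory's theorem), so their inverses differ by a positive real factor on the
carrier (`symm_eq_inv_smul_of_isChordalUniformizing`), and the logarithmic derivative `ψ′/ψ` does not see that factor
(`logDeriv_symm_eq_of_isChordalUniformizing`). Hence the identity for one chordal uniformizer gives it for all, with the
same constant (`identify_allUniformizers_of_one`, registered helper of the crux item).
-/

noncomputable section

namespace Summit.CriticalPhenomena.CardyFormulaZ2.Cruxes.ParafermionToSLESixFamilies.PotentialDarbouxPicardDiamond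

open scoped Topology
open Filter Set Complex
open UpperHalfPlane (upperHalfPlaneSet)
open Literature.Probability.RandomPlanarGeometry

/-- Two chordal uniformizers `φ, φ'` of the same Dobrushin domain have inverses differing by a positive real factor on
the carrier: `φ'⁻¹ = c⁻¹ · φ⁻¹` for the dilation constant `c > 0` of `exists_eq_trans_smul_holds` (`φ' = φ ∘ (c · )`). -/
theorem symm_eq_inv_smul_of_isChordalUniformizing (D : DobrushinDomain)
    (φ φ' : ConformalEquiv upperHalfPlaneSet D.carrier) (hφ : D.IsChordalUniformizing φ)
    (hφ' : D.IsChordalUniformizing φ') :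
    ∃ c : ℝ, 0 < c ∧ ∀ y ∈ D.carrier, φ'.symm y = ((c⁻¹ : ℝ) : ℂ) * φ.symm y := by
  obtain ⟨c, hc, heq⟩ := MarkedDomain.IsChordalUniformizing.exists_eq_trans_smul_holds hφ hφ'
  refine ⟨c, hc, fun y hy => ?_⟩
  have h1 : φ'.symm y ∈ upperHalfPlaneSet := φ'.symm_mapsTo hy
  have h2 : φ' (φ'.symm y) = y := φ'.apply_symm_apply hy
  have h3 : φ' (φ'.symm y) = φ ((c : ℂ) * φ'.symm y) := by
    have := heq h1
    rw [ConformalEquiv.trans_apply, ConformalEquiv.smulUpperHalfPlane_apply, real_smul] at this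
    exact this
  have h4 : (c : ℂ) * φ'.symm y ∈ upperHalfPlaneSet := by
    have := (ConformalEquiv.smulUpperHalfPlane c hc).mapsTo h1
    rwa [ConformalEquiv.smulUpperHalfPlane_apply, real_smul] at this
  have h5 : φ.symm y = (c : ℂ) * φ'.symm y := by
    have := φ.symm_apply_apply h4
    rw [← h3, h2] at this
    exact this
  have hc0 : (c : ℂ) ≠ 0 := by exact_mod_cast hc.ne'
  rw [h5, ← mul_assoc, ofReal_inv, inv_mul_cancel₀ hc0, one_mul]

/-- **Dilation invariance of `ψ′/ψ`.** For two chordal uniformizers `φ, φ'` of a Dobrushin domain, the logarithmic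
derivatives of the inverses agree on the carrier: `(φ'⁻¹)′/φ'⁻¹ = (φ⁻¹)′/φ⁻¹` (the inverses differ by a positive real
factor, and the carrier is open). -/
theorem logDeriv_symm_eq_of_isChordalUniformizing (D : DobrushinDomain)
    (φ φ' : ConformalEquiv upperHalfPlaneSet D.carrier) (hφ : D.IsChordalUniformizing φ)
    (hφ' : D.IsChordalUniformizing φ') :
    ∀ w ∈ D.carrier, deriv (fun x : ℂ => φ'.symm x) w / φ'.symm w =
      deriv (fun x : ℂ => φ.symm x) w / φ.symm w := by
  obtain ⟨c, hc, heq⟩ := symm_eq_inv_smul_of_isChordalUniformizing D φ φ' hφ hφ'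
  intro w hw
  have hev : (fun x : ℂ => φ'.symm x) =ᶠ[𝓝 w] fun x : ℂ => ((c⁻¹ : ℝ) : ℂ) * φ.symm x :=
    Filter.eventuallyEq_of_mem (D.isOpen.mem_nhds hw) fun x hx => heq x hx
  rw [hev.deriv_eq, heq w hw]
  have hcinv : ((c⁻¹ : ℝ) : ℂ) ≠ 0 := by exact_mod_cast (inv_pos.2 hc).ne'
  rw [deriv_const_mul_field', mul_div_mul_left _ _ hcinv]

/-- **"One chordal uniformizer suffices."** If `(G′)³ = c · ψ₀′/ψ₀` on the carrier for one chordal uniformizer `φ₀`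
(`ψ₀ = φ₀⁻¹`), then `(G′)³ = c · ψ′/ψ` for every chordal uniformizer `φ` (`ψ = φ⁻¹`), with the SAME constant `c` — the
form in which `PotentialConformalLimit` states the identification. -/
theorem identify_allUniformizers_of_one : ∀ (D : DobrushinDomain) (G : ℂ → ℂ) (c : ℂ) (φ₀ : ConformalEquiv upperHalfPlaneSet D.carrier), D.IsChordalUniformizing φ₀ → (∀ w ∈ D.carrier, deriv G w ^ 3 = c * (deriv (fun x : ℂ => φ₀.symm x) w / φ₀.symm w)) → ∀ φ : ConformalEquiv upperHalfPlaneSet D.carrier, D.IsChordalUniformizing φ → ∀ w ∈ D.carrier, deriv G w ^ 3 = c * (deriv (fun x : ℂ => φ.symm x) w / φ.symm w) := by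
  intro D G c φ₀ hφ₀ hG φ hφ w hw
  rw [hG w hw, logDeriv_symm_eq_of_isChordalUniformizing D φ φ₀ hφ hφ₀ w hw]

end Summit.CriticalPhenomena.CardyFormulaZ2.Cruxes.ParafermionToSLESixFamilies.PotentialDarbouxPicardDiamond

end
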